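import Summits.BirchSwinnertonDyer.BirchSwinnertonDyer.Theorems.EisensteinPrimesMazurMCOnX1RankZeroInterludeSelmerIsogenyKernels
import Summits.BirchSwinnertonDyer.BirchSwinnertonDyer.Theorems.EisensteinPrimesMazurMCOnX1RankZeroInterludeMuMonotone
import Summits.BirchSwinnertonDyer.BirchSwinnertonDyer.Theorems.EisensteinPrimesMazurMCOnX1RankZeroInterludeCyclicIsogenyPrimeStep
import Literature.NumberTheory.EllipticCurves.RationalIsogenyDegreesProofs
import Literature.NumberTheory.EllipticCurves.BSDSelmerCMPConverseMaximalOrderProofs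
import HarnessLib

/-!
# Crux `MazurMCOnX1RankZero` (item stmt-BirchSwinnertonDyer-19035), line `interlude_with_torsion`, road B ASSEMBLED:
# K2⁺-μ and K2⁺ (isogeny invariance of `char 𝔛_Gr(·/K_∞⁺)` on the CYCLOTOMIC line) FROM the finiteness of the Selmer
# kernel along ONE `ℚ`-isogeny of degree exactly `p`

Cell `bsd-eis` (host `run/shared/lean/pub/bsd-eis/`), LEAD `cruxlead-19035` (g0); `--supports`
stmt-BirchSwinnertonDyer-19035 as a HELPER. Content = the sorry-free road-B reductions (B0), (B1), (B2) and the `ℓ ≠ p`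
case of the bsd-idea-11 supplement line `Cruxes/MazurMCOnX1RankZero/Lines/interlude_stepsTwoThree_split_idea11g6.lean`
(REV 8.1–8.5, mathematics by seat bsd-idea-11 g15, kernel-checked there), recomposed over the landed helper files
`…InterludeSelmerIsogenyMaps`, `…InterludeSelmerIsogenyKernels`, `…InterludeMuMonotone`, `…InterludeCyclicIsogenyPrimeStep`
with every `def … : Prop` currency of the line UNFOLDED. UNCONDITIONAL; NOTHING is asserted about BSD, Mazur's main
conjecture or IMC2 — the two theorems at the end are IMPLICATIONS whose hypothesis, (B1c) at degree `p`
(`KerSelmerMapFiniteOfDegreeP` of the line = registered stub `stub_roadBResidueP` once `ResidualGL1FinitenessOdd` is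
supplied), is OPEN.

WHAT.
* (B1) `mu_eq_of_finite_ker_acSelmerMap`: over ANY number field `K`, `ℤ_p`-extension `κ`, strict place `𝔭`, for
  isogenies `φ : W₁ → W₂`, `ψ : W₂ → W₁` over `K` whose Selmer maps `Sel_𝔭^∅(K_∞, ·)` have finite kernel and `𝔛(W₁)`
  torsion: `𝔛(W₂)` is torsion and `μ(𝔛(W₁)) = μ(𝔛(W₂))` (Pontryagin duality + `μ`-monotonicity, previous files).
* (B2)+(ℓ ≠ p) `finite_ker_acSelmerMap_of_isCyclic_of_degreeP`: if the Selmer kernel is finite along every `ℚ`-isogeny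
  of degree EXACTLY `p` between good-at-`p` curves (the hypothesis, unfolded `KerSelmerMapFiniteOfDegreeP`), then it is
  finite along every CYCLIC `ℚ`-isogeny (strong induction on the degree through the prime step; `ℓ ≠ p` injective).
* (B0) assembled: `xGrMuIsogenyInvariantCyc_of_kerSelmerMapFiniteOfDegreeP` — the line's K2⁺-μ currency
  `XGrMuIsogenyInvariantCyc` (unfolded) from that hypothesis (a cyclic `ℚ`-isogeny each way exists, AEC III.4.11); and,
  joined with K2⁺-e (`xGrIsogenyInvariantAwayFromP`), the line's K2⁺ currency `XGrCharIdealIsogenyInvariantCyc` (unfolded):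
  `xGrCharIdealIsogenyInvariantCyc_of_kerSelmerMapFiniteOfDegreeP`.
References: Greenberg, LNM 1716 §5 (proof of Prop. 5.10), §1; Silverman AEC Cor. III.4.11, Thm. III.6.1–6.2, Cor. VII.7.2;
Perrin-Riou, ASPM 17 (1989) p. 349 (the printed statement this replaces on the cyclotomic line).
-/

set_option linter.dupNamespace false
set_option autoImplicit false

noncomputable section

open scoped Classical

open WeierstrassCurve NumberField IsDedekindDomain Field
  Literature.NumberTheory.EllipticCurves Literature.NumberTheory.GaloisRepresentations
  Literature.NumberTheory.EllipticCurves.Rank1Residual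
  Literature.NumberTheory.EllipticCurves.Castella2018 Literature.NumberTheory.QuadraticFields

namespace Summit.BirchSwinnertonDyer.BirchSwinnertonDyer.Theorems.InterludeWithTorsion

/-! ## (B1) assembled over any number field: finite Selmer kernels each way ⟹ equal `μ` -/

/-- **Road B (B1), both directions**: along isogenies `φ : W₁ → W₂`, `ψ : W₂ → W₁` over a number field `K` whose Selmer
maps over `K_∞ = K̄^{ker κ}` (strict at `𝔭`, `Σ = ∅`) have FINITE kernel, with `𝔛(W₁)` torsion: `𝔛(W₂)` is torsion and
`μ(𝔛(W₁)) = μ(𝔛(W₂))` (`K2e.muInvariant_le_of_finite_ker` twice; finite generation from `AcSelmer.XAc.module_finite_empty`).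
[cite: GreenbergLNM1716, §5, proof of Prop. 5.10] -/
theorem mu_eq_of_finite_ker_acSelmerMap {K : Type} [Field K] [NumberField K] {W₁ W₂ : WeierstrassCurve K}
    [W₁.IsElliptic] [W₂.IsElliptic] (p : ℕ) [Fact p.Prime] (κ : ZpExtension K p) (𝔭 : HeightOneSpectrum (𝓞 K))
    (γ : absoluteGaloisGroup K) [Fact (κ.IsTopGenerator γ)]
    (φ : Isogeny W₁ W₂) (ψ : Isogeny W₂ W₁)
    (hφ : Finite (K2e.acSelmerMap p κ 𝔭 ∅ φ.toAddMonoidHom φ.equivariant).ker)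
    (hψ : Finite (K2e.acSelmerMap p κ 𝔭 ∅ ψ.toAddMonoidHom ψ.equivariant).ker)
    (htors : Module.IsTorsion (IwasawaAlgebra p) (AcSelmer.XAc W₁ p κ 𝔭 ∅ γ)) :
    Module.IsTorsion (IwasawaAlgebra p) (AcSelmer.XAc W₂ p κ 𝔭 ∅ γ) ∧
      muInvariant p (AcSelmer.XAc W₁ p κ 𝔭 ∅ γ) = muInvariant p (AcSelmer.XAc W₂ p κ 𝔭 ∅ γ) := by
  haveI : Module.Finite (IwasawaAlgebra p) (AcSelmer.XAc W₁ p κ 𝔭 ∅ γ) :=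
    AcSelmer.XAc.module_finite_empty (W := W₁) (p := p) (κ := κ) (𝔭 := 𝔭) (γ := γ)
  haveI : Module.Finite (IwasawaAlgebra p) (AcSelmer.XAc W₂ p κ 𝔭 ∅ γ) :=
    AcSelmer.XAc.module_finite_empty (W := W₂) (p := p) (κ := κ) (𝔭 := 𝔭) (γ := γ)
  obtain ⟨htors₂, h21⟩ :=
    K2e.muInvariant_le_of_finite_ker p κ 𝔭 ∅ γ ψ.toAddMonoidHom ψ.equivariant htors hψ
  obtain ⟨_, h12⟩ :=
    K2e.muInvariant_le_of_finite_ker p κ 𝔭 ∅ γ φ.toAddMonoidHom φ.equivariant htors₂ hφ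
  exact ⟨htors₂, le_antisymm h12 h21⟩

/-! ## (B2) + (ℓ ≠ p): from ONE `ℚ`-isogeny of degree exactly `p` to every cyclic `ℚ`-isogeny -/

/-- **From prime degree to every cyclic `ℚ`-isogeny** (strong induction on the degree): `Sel(ψ₀/K) = Sel(λ/K) ∘ Sel(g/K)`
along the prime step `ψ₀ = λ ∘ g` (`exists_prime_degree_factor_of_isCyclic`), finite kernels compose
(`K2e.finite_ker_comp`), degree `1` is the injective base case, and good reduction at `p` passes to the middle curve
(`IsIsogenous.hasGoodReductionAtPrime_iff`). Hypothesis = the line's `KerSelmerMapFiniteOfPrimeDegree`, conclusion = its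
`KerSelmerMapFiniteOfCyclic` (without the unused minimality binders), both unfolded.
[cite: SilvermanAEC2009, Cor. III.4.11, Cor. VII.7.2] [cite: GreenbergLNM1716, §5, proof of Prop. 5.10] -/
theorem finite_ker_acSelmerMap_of_isCyclic_of_prime
    (h : ∀ (W W' : WeierstrassCurve ℚ) [W.IsElliptic] [W'.IsElliptic] (p : ℕ) [Fact p.Prime],
        2 < p → W.HasGoodReductionAtPrime p → W'.HasGoodReductionAtPrime p →
        ∀ (ψ₀ : Isogeny W W'), ψ₀.degree.Prime →
        ∀ (K : Type) [Field K] [NumberField K], IsImaginaryQuadratic K →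
        ∀ (v vbar : HeightOneSpectrum (𝓞 K)),
          ((p : ℕ) : 𝓞 K) ∈ v.asIdeal → ((p : ℕ) : 𝓞 K) ∈ vbar.asIdeal → vbar ≠ v →
        ∀ (κ : ZpExtension K p), κ.IsCyclotomic →
          Finite (K2e.acSelmerMap p κ vbar ∅ (ψ₀.extendScalars K).toAddMonoidHom
            (ψ₀.extendScalars K).equivariant).ker) :
    ∀ (W W' : WeierstrassCurve ℚ) [W.IsElliptic] [W'.IsElliptic] (p : ℕ) [Fact p.Prime],
      2 < p → W.HasGoodReductionAtPrime p → W'.HasGoodReductionAtPrime p →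
      ∀ (ψ₀ : Isogeny W W'), ψ₀.IsCyclic →
      ∀ (K : Type) [Field K] [NumberField K], IsImaginaryQuadratic K →
      ∀ (v vbar : HeightOneSpectrum (𝓞 K)),
        ((p : ℕ) : 𝓞 K) ∈ v.asIdeal → ((p : ℕ) : 𝓞 K) ∈ vbar.asIdeal → vbar ≠ v →
      ∀ (κ : ZpExtension K p), κ.IsCyclotomic →
        Finite (K2e.acSelmerMap p κ vbar ∅ (ψ₀.extendScalars K).toAddMonoidHom
          (ψ₀.extendScalars K).equivariant).ker := by
  suffices H : ∀ (n : ℕ) (W W' : WeierstrassCurve ℚ) [W.IsElliptic] [W'.IsElliptic] (p : ℕ) [Fact p.Prime],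
      2 < p → W.HasGoodReductionAtPrime p → W'.HasGoodReductionAtPrime p →
      ∀ (ψ₀ : Isogeny W W'), ψ₀.IsCyclic → ψ₀.degree = n →
      ∀ (K : Type) [Field K] [NumberField K], IsImaginaryQuadratic K →
      ∀ (v vbar : HeightOneSpectrum (𝓞 K)),
        ((p : ℕ) : 𝓞 K) ∈ v.asIdeal → ((p : ℕ) : 𝓞 K) ∈ vbar.asIdeal → vbar ≠ v →
      ∀ (κ : ZpExtension K p), κ.IsCyclotomic →
        Finite (K2e.acSelmerMap p κ vbar ∅ (ψ₀.extendScalars K).toAddMonoidHom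
          (ψ₀.extendScalars K).equivariant).ker by
    intro W W' _ _ p _ hp hgood hgood' ψ₀ hψ₀ K _ _ hK v vbar hv hvbar hne κ hcyc
    exact H _ W W' p hp hgood hgood' ψ₀ hψ₀ rfl K hK v vbar hv hvbar hne κ hcyc
  intro n
  induction n using Nat.strong_induction_on with
  | _ n ih =>
    intro W W' _ _ p _ hp hgood hgood' ψ₀ hψ₀ hn K _ _ hK v vbar hv hvbar hne κ hcyc
    by_cases h1 : ψ₀.degree = 1
    · -- base case: `ψ₀/K` is a bijection on `K̄`-points
      apply K2e.finite_ker_acSelmerMap_of_bijective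
      have hker : (ψ₀.extendScalars K).degree = 1 := by rw [Isogeny.degree_extendScalars]; exact h1
      refine ⟨(injective_iff_map_eq_zero _).mpr fun Q hQ ↦ ?_, (ψ₀.extendScalars K).surjective⟩
      have hsub := (Nat.card_eq_one_iff_unique.mp hker).1
      have hmem : Q ∈ (ψ₀.extendScalars K).toAddMonoidHom.ker := by rw [AddMonoidHom.mem_ker]; exact hQ
      exact congrArg Subtype.val (Subsingleton.elim (⟨Q, hmem⟩ : (ψ₀.extendScalars K).toAddMonoidHom.ker)
        ⟨0, AddSubgroup.zero_mem _⟩)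
    · obtain ⟨W₁, _, g, lam, hgp, hlam, hlt, hcomp⟩ :=
        exists_prime_degree_factor_of_isCyclic W W' ψ₀ hψ₀ h1
      have hiso₁ : IsIsogenous W W₁ := ⟨g⟩
      have hgood₁ : W₁.HasGoodReductionAtPrime p := (hiso₁.hasGoodReductionAtPrime_iff p).mp hgood
      have hfin_g := h W W₁ p hp hgood hgood₁ g hgp K hK v vbar hv hvbar hne κ hcyc
      have hfin_lam := ih lam.degree (hn ▸ hlt) W₁ W' p hp hgood₁ hgood' lam hlam rfl K hK v vbar hv hvbar
        hne κ hcyc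
      -- `ψ₀/K = λ/K ∘ g/K` on `K̄`-points
      have hpt : (ψ₀.extendScalars K).toAddMonoidHom =
          (lam.extendScalars K).toAddMonoidHom.comp (g.extendScalars K).toAddMonoidHom := by
        ext Q
        obtain ⟨P, rfl⟩ := (W.geomPointsExtend K
          (Literature.NumberTheory.GaloisRepresentations.absClosureEquiv ℚ K)).surjective Q
        change (ψ₀.extendScalarsOfAlgEquiv _) _ =
          (lam.extendScalarsOfAlgEquiv _) ((g.extendScalarsOfAlgEquiv _) _)
        rw [Isogeny.extendScalarsOfAlgEquiv_apply_geomPointsExtend,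
          Isogeny.extendScalarsOfAlgEquiv_apply_geomPointsExtend,
          Isogeny.extendScalarsOfAlgEquiv_apply_geomPointsExtend, hcomp]
      have hgf : ∀ (σ : absoluteGaloisGroup K) (Q : (W.baseChange K).geomPoints),
          (lam.extendScalars K).toAddMonoidHom.comp (g.extendScalars K).toAddMonoidHom (σ • Q) =
            σ • (lam.extendScalars K).toAddMonoidHom.comp (g.extendScalars K).toAddMonoidHom Q :=
        fun σ Q ↦ by rw [← hpt]; exact (ψ₀.extendScalars K).equivariant σ Q
      rw [K2e.acSelmerMap_congr p κ vbar ∅ hpt (ψ₀.extendScalars K).equivariant hgf]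
      have hfun : K2e.acSelmerMap p κ vbar ∅
            ((lam.extendScalars K).toAddMonoidHom.comp (g.extendScalars K).toAddMonoidHom) hgf =
          (K2e.acSelmerMap p κ vbar ∅ (lam.extendScalars K).toAddMonoidHom (lam.extendScalars K).equivariant).comp
            (K2e.acSelmerMap p κ vbar ∅ (g.extendScalars K).toAddMonoidHom (g.extendScalars K).equivariant) := by
        ext c
        exact congrArg Subtype.val (K2e.acSelmerMap_acSelmerMap p κ vbar ∅ (g.extendScalars K).toAddMonoidHom
          (g.extendScalars K).equivariant (lam.extendScalars K).toAddMonoidHom (lam.extendScalars K).equivariant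
          hgf c).symm
      rw [hfun]
      exact K2e.finite_ker_comp _ _ hfin_g hfin_lam

/-- **The `ℓ ≠ p` case is free**: a prime degree `ℓ ≠ p` is prime to `p`, `deg(ψ₀/K) = deg ψ₀`, and the Selmer kernel is
trivial (`K2e.finite_ker_acSelmerMap_of_coprime`); so the line's (B1c) at degree EXACTLY `p` (`KerSelmerMapFiniteOfDegreeP`,
unfolded, the hypothesis) gives it at every prime degree. [cite: SilvermanAEC2009, Thm. III.6.2] [cite: GreenbergLNM1716, §5, proof of Prop. 5.10] -/
theorem finite_ker_acSelmerMap_of_prime_of_degreeP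
    (h : ∀ (W W' : WeierstrassCurve ℚ) [W.IsElliptic] [W'.IsElliptic] (p : ℕ) [Fact p.Prime],
        2 < p → W.HasGoodReductionAtPrime p → W'.HasGoodReductionAtPrime p →
        ∀ (ψ₀ : Isogeny W W'), ψ₀.degree = p →
        ∀ (K : Type) [Field K] [NumberField K], IsImaginaryQuadratic K →
        ∀ (v vbar : HeightOneSpectrum (𝓞 K)),
          ((p : ℕ) : 𝓞 K) ∈ v.asIdeal → ((p : ℕ) : 𝓞 K) ∈ vbar.asIdeal → vbar ≠ v →
        ∀ (κ : ZpExtension K p), κ.IsCyclotomic →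
          Finite (K2e.acSelmerMap p κ vbar ∅ (ψ₀.extendScalars K).toAddMonoidHom
            (ψ₀.extendScalars K).equivariant).ker) :
    ∀ (W W' : WeierstrassCurve ℚ) [W.IsElliptic] [W'.IsElliptic] (p : ℕ) [Fact p.Prime],
      2 < p → W.HasGoodReductionAtPrime p → W'.HasGoodReductionAtPrime p →
      ∀ (ψ₀ : Isogeny W W'), ψ₀.degree.Prime →
      ∀ (K : Type) [Field K] [NumberField K], IsImaginaryQuadratic K →
      ∀ (v vbar : HeightOneSpectrum (𝓞 K)),
        ((p : ℕ) : 𝓞 K) ∈ v.asIdeal → ((p : ℕ) : 𝓞 K) ∈ vbar.asIdeal → vbar ≠ v →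
      ∀ (κ : ZpExtension K p), κ.IsCyclotomic →
        Finite (K2e.acSelmerMap p κ vbar ∅ (ψ₀.extendScalars K).toAddMonoidHom
          (ψ₀.extendScalars K).equivariant).ker := by
  intro W W' _ _ p _ hp hgood hgood' ψ₀ hprime K _ _ hK v vbar hv hvbar hne κ hcyc
  by_cases hdeg : ψ₀.degree = p
  · exact h W W' p hp hgood hgood' ψ₀ hdeg K hK v vbar hv hvbar hne κ hcyc
  · have hcop : (ψ₀.extendScalars K).degree.Coprime p := by
      rw [Isogeny.degree_extendScalars]
      exact (Nat.coprime_primes hprime Fact.out).mpr hdeg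
    haveI : (W.baseChange K).IsElliptic := inferInstanceAs ((W.map (algebraMap ℚ K)).IsElliptic)
    haveI : (W'.baseChange K).IsElliptic := inferInstanceAs ((W'.map (algebraMap ℚ K)).IsElliptic)
    exact K2e.finite_ker_acSelmerMap_of_coprime p κ vbar ∅ (ψ₀.extendScalars K) hcop

/-! ## (B0) assembled: the line's K2⁺-μ and K2⁺ currencies from (B1c) at degree `p` -/

/-- **K2⁺-μ FROM (B1c) AT DEGREE `p`** — the line's currency `XGrMuIsogenyInvariantCyc` (unfolded) from its
`KerSelmerMapFiniteOfDegreeP` (unfolded): a cyclic `ℚ`-isogeny each way exists (`Isogeny.exists_isCyclic_degree_dvd` on an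
isogeny and on a dual, `Isogeny.exists_dual_of_isElliptic`), good reduction at `p` moves along the class
(`IsIsogenous.hasGoodReductionAtPrime_iff`), the Selmer kernels along their base changes to `K` are finite by the two
previous theorems, and (B1) gives torsion and equal `μ`. On the cyclotomic line this replaces Perrin-Riou's printed
`μ`-variation formula (ASPM 17 p. 349, one index at every `v ∣ p`) for the balanced Greenberg datum (relaxed `v`, strict `v̄`).
[cite: GreenbergLNM1716, §5, proof of Prop. 5.10] [cite: SilvermanAEC2009, Cor. III.4.11, Thm. III.6.1] [cite: PerrinRiou1989ASPM, Théorème (p. 349)] -/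
theorem xGrMuIsogenyInvariantCyc_of_kerSelmerMapFiniteOfDegreeP
    (h : ∀ (W W' : WeierstrassCurve ℚ) [W.IsElliptic] [W'.IsElliptic] (p : ℕ) [Fact p.Prime],
        2 < p → W.HasGoodReductionAtPrime p → W'.HasGoodReductionAtPrime p →
        ∀ (ψ₀ : Isogeny W W'), ψ₀.degree = p →
        ∀ (K : Type) [Field K] [NumberField K], IsImaginaryQuadratic K →
        ∀ (v vbar : HeightOneSpectrum (𝓞 K)),
          ((p : ℕ) : 𝓞 K) ∈ v.asIdeal → ((p : ℕ) : 𝓞 K) ∈ vbar.asIdeal → vbar ≠ v →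
        ∀ (κ : ZpExtension K p), κ.IsCyclotomic →
          Finite (K2e.acSelmerMap p κ vbar ∅ (ψ₀.extendScalars K).toAddMonoidHom
            (ψ₀.extendScalars K).equivariant).ker) :
    ∀ (W₁ W₂ : WeierstrassCurve ℚ) [W₁.IsElliptic] [W₁.IsGloballyMinimal] [W₂.IsElliptic]
      [W₂.IsGloballyMinimal] (p : ℕ) [Fact p.Prime],
      2 < p → W₁.HasGoodReductionAtPrime p → IsIsogenous W₁ W₂ →
      ∀ (K : Type) [Field K] [NumberField K], IsImaginaryQuadratic K →
        SatisfiesHeegnerHypothesis (W₁.conductorNorm ℤ) K → SatisfiesHeegnerHypothesis p K →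
        Odd (NumberField.discr K) → NumberField.discr K ≠ -3 →
      ∀ (v vbar : HeightOneSpectrum (𝓞 K)),
        ((p : ℕ) : 𝓞 K) ∈ v.asIdeal → ((p : ℕ) : 𝓞 K) ∈ vbar.asIdeal → vbar ≠ v →
      ∀ (κ : ZpExtension K p), κ.IsCyclotomic →
      ∀ (γ : absoluteGaloisGroup K) [Fact (κ.IsTopGenerator γ)],
        Module.IsTorsion (IwasawaAlgebra p) (AcSelmer.XAc (W₁.baseChange K) p κ vbar ∅ γ) →
        muInvariant p (AcSelmer.XAc (W₁.baseChange K) p κ vbar ∅ γ) =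
          muInvariant p (AcSelmer.XAc (W₂.baseChange K) p κ vbar ∅ γ) := by
  intro W₁ W₂ _ _ _ _ p _ hp hgood hiso K _ _ hK _ _ _ _ v vbar hv hvbar hne κ hcyc γ _ htors
  haveI : (W₁.baseChange K).IsElliptic := inferInstanceAs ((W₁.map (algebraMap ℚ K)).IsElliptic)
  haveI : (W₂.baseChange K).IsElliptic := inferInstanceAs ((W₂.map (algebraMap ℚ K)).IsElliptic)
  have hcyc_case := finite_ker_acSelmerMap_of_isCyclic_of_prime (finite_ker_acSelmerMap_of_prime_of_degreeP h)
  have hgood₂ : W₂.HasGoodReductionAtPrime p := (hiso.hasGoodReductionAtPrime_iff p).mp hgood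
  obtain ⟨φ₀⟩ := hiso
  obtain ⟨ψ₀, hψ₀, -⟩ := φ₀.exists_isCyclic_degree_dvd
  obtain ⟨φ₀', -⟩ := φ₀.exists_dual_of_isElliptic
  obtain ⟨ψ₀', hψ₀', -⟩ := φ₀'.exists_isCyclic_degree_dvd
  exact (mu_eq_of_finite_ker_acSelmerMap p κ vbar γ (ψ₀.extendScalars K) (ψ₀'.extendScalars K)
    (hcyc_case W₁ W₂ p hp hgood hgood₂ ψ₀ hψ₀ K hK v vbar hv hvbar hne κ hcyc)
    (hcyc_case W₂ W₁ p hp hgood₂ hgood ψ₀' hψ₀' K hK v vbar hv hvbar hne κ hcyc) htors).2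

/-- **K2⁺ FROM (B1c) AT DEGREE `p`** — the line's currency `XGrCharIdealIsogenyInvariantCyc` (unfolded: along a
`ℚ`-isogeny, `𝔛_Gr(W₂/K_∞⁺)` is torsion once `𝔛_Gr(W₁/K_∞⁺)` is, with the SAME characteristic ideal) from
`KerSelmerMapFiniteOfDegreeP` (unfolded): K2⁺-e (`xGrIsogenyInvariantAwayFromP`: equal lengths at every height-one
`𝔮 ≠ (p)`) and K2⁺-μ (previous theorem: equal `μ`) joined factor by factor (`charIdeal_eq_of_lengthAt_eq_of_mu_eq`).
[cite: GreenbergLNM1716, §1 (paragraph before Conj. 1.11)] [cite: PerrinRiou1989ASPM, Théorème (p. 349)] -/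
theorem xGrCharIdealIsogenyInvariantCyc_of_kerSelmerMapFiniteOfDegreeP
    (h : ∀ (W W' : WeierstrassCurve ℚ) [W.IsElliptic] [W'.IsElliptic] (p : ℕ) [Fact p.Prime],
        2 < p → W.HasGoodReductionAtPrime p → W'.HasGoodReductionAtPrime p →
        ∀ (ψ₀ : Isogeny W W'), ψ₀.degree = p →
        ∀ (K : Type) [Field K] [NumberField K], IsImaginaryQuadratic K →
        ∀ (v vbar : HeightOneSpectrum (𝓞 K)),
          ((p : ℕ) : 𝓞 K) ∈ v.asIdeal → ((p : ℕ) : 𝓞 K) ∈ vbar.asIdeal → vbar ≠ v →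
        ∀ (κ : ZpExtension K p), κ.IsCyclotomic →
          Finite (K2e.acSelmerMap p κ vbar ∅ (ψ₀.extendScalars K).toAddMonoidHom
            (ψ₀.extendScalars K).equivariant).ker) :
    ∀ (W₁ W₂ : WeierstrassCurve ℚ) [W₁.IsElliptic] [W₁.IsGloballyMinimal] [W₂.IsElliptic]
      [W₂.IsGloballyMinimal] (p : ℕ) [Fact p.Prime],
      2 < p → W₁.HasGoodReductionAtPrime p → IsIsogenous W₁ W₂ →
      ∀ (K : Type) [Field K] [NumberField K], IsImaginaryQuadratic K →
        SatisfiesHeegnerHypothesis (W₁.conductorNorm ℤ) K → SatisfiesHeegnerHypothesis p K →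
        Odd (NumberField.discr K) → NumberField.discr K ≠ -3 →
      ∀ (v vbar : HeightOneSpectrum (𝓞 K)),
        ((p : ℕ) : 𝓞 K) ∈ v.asIdeal → ((p : ℕ) : 𝓞 K) ∈ vbar.asIdeal → vbar ≠ v →
      ∀ (κ : ZpExtension K p), κ.IsCyclotomic →
      ∀ (γ : absoluteGaloisGroup K) [Fact (κ.IsTopGenerator γ)],
        Module.IsTorsion (IwasawaAlgebra p) (AcSelmer.XAc (W₁.baseChange K) p κ vbar ∅ γ) →
        Module.IsTorsion (IwasawaAlgebra p) (AcSelmer.XAc (W₂.baseChange K) p κ vbar ∅ γ) ∧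
        AcSelmer.XAc.charIdeal (W₁.baseChange K) p κ vbar ∅ γ =
          AcSelmer.XAc.charIdeal (W₂.baseChange K) p κ vbar ∅ γ := by
  intro W₁ W₂ _ _ _ _ p _ hp hgood hiso K _ _ hK hHN hHp hodd h3 v vbar hv hvbar hne κ hκ γ _ htors
  obtain ⟨htors₂, hlen⟩ := xGrIsogenyInvariantAwayFromP W₁ W₂ p hp hgood hiso K hK hHN hHp hodd h3 v vbar hv
    hvbar hne κ hκ γ htors
  exact ⟨htors₂, charIdeal_eq_of_lengthAt_eq_of_mu_eq p _ _ hlen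
    (xGrMuIsogenyInvariantCyc_of_kerSelmerMapFiniteOfDegreeP h W₁ W₂ p hp hgood hiso K hK hHN hHp hodd h3 v vbar
      hv hvbar hne κ hκ γ htors)⟩

end Summit.BirchSwinnertonDyer.BirchSwinnertonDyer.Theorems.InterludeWithTorsion

end
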